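import Mathlib
import Summits.NavierStokesRegularity.NavierStokesRegularity.Theorems.FilamentSkeletonRssSelectionBoxRJRungPartnerForcing

/-!
# Route `FilamentSkeletonRss` · crux `SelectionBoxRJ` (stmt-NavierStokesRegularity-21220) — rung tools (R2, brick 1):
# `‖f − U‖ ≤ 28 θ √Γ` for the TRUE partner field along a near-straight `R_π`-symmetric pair

Lane `ns-filament-19175-p1` (g7); helper file `--supports stmt-NavierStokesRegularity-21220`, route-independent.  The main
estimate announced in `…RungPartnerForcing.lean`:

* `partnerField_sub_U_le` — if `z` is `C¹` with unit speed, `z 0 = P = (√Γ/5, 0, 0)` and `‖z′ − e‖ ≤ θ ≤ 1/500` on `ℝ`, then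
  the regularised Biot–Savart field (box kernel, core `1`, circulation parameter `γ = 4`) of the partner `R_π ∘ z`
  (`R_π y = 2⟪y, e₃⟫e₃ − y`) evaluated at the moving point `z t` differs from the frozen rung-0 forcing `U t` by at most
  `28 θ √Γ`, for every `t`.

Proof: `(Γ/π)·[u[R_π z](z t) − u[ℓ₂](z t)]` by g6's `biotSavart_curveLipschitz` (pivot form, distances and linear escape from
`nearStraight_sep_rot/_line`; contributes `≤ (51/2)θ√Γ`), plus `(Γ/π)·[u[ℓ₂](z t) − u[ℓ₂](ℓ₁ t)]` by the two-point bound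
`lineField_two_point` for the closed-form line field (contributes `≤ (5/2)θ√Γ`), and `U t = (Γ/π)·u[ℓ₂](ℓ₁ t)`
(`U_eq_lineBiotSavart`).  This is the `C⁰` input `ε₀ = 28θ` for the zero package of the model rung with the TRUE partner.

HONEST FRAMING.  Kernel bookkeeping for the rung ladder of a HYPOTHETICAL filament box; nothing here is a claim about
Navier–Stokes regularity or blow-up.
-/

set_option linter.dupNamespace false -- `Theorems.…Theorems`-style path/namespace repetition is the tree convention

noncomputable section

namespace Summit.NavierStokesRegularity.NavierStokesRegularity.Theorems

open Set Function Filter MeasureTheory Real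
open Literature.Analysis.FluidPDE
open Summit.NavierStokesRegularity.NavierStokesRegularity.Theorems.SkeletonEquilibrium.Sketch
open scoped InnerProductSpace Topology

namespace SelectionBoxRJRung

/-- `‖ℓ₂ u‖² = Γ/25 + u²` for the partner line `ℓ₂ u = (−√Γ/5, 0, 0) + u(0, −1/√2, 1/√2)` (`Γ ≥ 0`). [folklore] -/
theorem norm_sq_line₂ (Γ u : ℝ) (hΓ : 0 ≤ Γ) :
    ‖(WithLp.toLp 2 ![-(Real.sqrt Γ / 5), 0, 0] : EuclideanSpace ℝ (Fin 3)) +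
        u • WithLp.toLp 2 ![0, -(Real.sqrt 2)⁻¹, (Real.sqrt 2)⁻¹]‖ ^ 2 = Γ / 25 + u ^ 2 := by
  rw [smul_vec3, add_vec3, VortexFilament.norm_sq_toLp_three]
  have hs := inv_sqrt_two_mul_self
  have hG : Real.sqrt Γ * Real.sqrt Γ = Γ := Real.mul_self_sqrt hΓ
  simp only [add_zero, mul_zero, zero_add]
  linear_combination (2 * u ^ 2) * hs + (1 / 25) * hG

/-- `R_π e = e₂`: the rotation by `π` about `e₃` maps the rung-0 direction to the partner's. [folklore] -/
theorem rotPi_tangent :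
    (2 * ⟪(WithLp.toLp 2 ![0, (Real.sqrt 2)⁻¹, (Real.sqrt 2)⁻¹] : EuclideanSpace ℝ (Fin 3)), EuclideanSpace.single 2 1⟫_ℝ) •
        (EuclideanSpace.single (2 : Fin 3) (1 : ℝ)) -
      (WithLp.toLp 2 ![0, (Real.sqrt 2)⁻¹, (Real.sqrt 2)⁻¹] : EuclideanSpace ℝ (Fin 3)) =
      WithLp.toLp 2 ![0, -(Real.sqrt 2)⁻¹, (Real.sqrt 2)⁻¹] := by
  have h := rotPi_line 0 1
  simp only [Real.sqrt_zero, zero_div, neg_zero, one_smul] at h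
  have h0 : (WithLp.toLp 2 ![(0:ℝ), 0, 0] : EuclideanSpace ℝ (Fin 3)) = 0 := by
    ext i; fin_cases i <;> simp
  rw [h0, zero_add, zero_add] at h
  exact h

/-- Numeric bound for Term A: with `c = 1 − 2θ`, `D = c·(2/5)√Γ`, the curve-Lipschitz constant times the circulation
factor is `(Γ/π)·2πθD(cD + 4D)/(c²D³) = 5√Γθ(c + 4)/c³ ≤ (51/2)θ√Γ` for `0 ≤ θ ≤ 1/500`. [folklore] -/
theorem termA_bound {Γ θ : ℝ} (hΓ : 0 < Γ) (hθ0 : 0 ≤ θ) (hθ1 : θ ≤ 1 / 500) :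
    Γ * 4 / (4 * Real.pi) * (2 * Real.pi * θ * ((1 - 2 * θ) * (2 * Real.sqrt Γ / 5)) *
      ((1 - 2 * θ) * ((1 - 2 * θ) * (2 * Real.sqrt Γ / 5)) + 4 * ((1 - 2 * θ) * (2 * Real.sqrt Γ / 5))) /
      ((1 - 2 * θ) ^ 2 * ((1 - 2 * θ) * (2 * Real.sqrt Γ / 5)) ^ 3)) ≤ 51 / 2 * θ * Real.sqrt Γ := by
  have hG : 0 < Real.sqrt Γ := Real.sqrt_pos.2 hΓ
  have hG2 : Real.sqrt Γ ^ 2 = Γ := Real.sq_sqrt hΓ.le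
  have hc : 0 < 1 - 2 * θ := by linarith
  have hc3 : 0 < (1 - 2 * θ) ^ 3 := pow_pos hc 3
  have heq : Γ * 4 / (4 * Real.pi) * (2 * Real.pi * θ * ((1 - 2 * θ) * (2 * Real.sqrt Γ / 5)) *
      ((1 - 2 * θ) * ((1 - 2 * θ) * (2 * Real.sqrt Γ / 5)) + 4 * ((1 - 2 * θ) * (2 * Real.sqrt Γ / 5))) /
      ((1 - 2 * θ) ^ 2 * ((1 - 2 * θ) * (2 * Real.sqrt Γ / 5)) ^ 3)) =
      5 * Real.sqrt Γ * θ * ((1 - 2 * θ) + 4) / (1 - 2 * θ) ^ 3 := by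
    have hcne : (1 - 2 * θ) ≠ 0 := hc.ne'
    have hπ : Real.pi ≠ 0 := Real.pi_pos.ne'
    generalize hGdef : Real.sqrt Γ = G at hG hG2 ⊢
    subst hG2
    have hG0 : G ≠ 0 := hG.ne'
    field_simp
  rw [heq, div_le_iff₀ hc3]
  have h096 : (249 / 250 : ℝ) ≤ 1 - 2 * θ := by linarith
  have hc3' : (249 / 250 : ℝ) ^ 3 ≤ (1 - 2 * θ) ^ 3 := pow_le_pow_left₀ (by norm_num) h096 3
  nlinarith [mul_nonneg hθ0 hG.le, hc3', mul_nonneg (mul_nonneg hθ0 hG.le) (sub_nonneg.2 hc3')]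

/-- Numeric bound for Term B: `(Γ/π)·6θ|t|/((1 − θ)N₁)² ≤ (5/2)θ√Γ` when `N₁² = 4Γ/25 + t²` (so `|t|/N₁² ≤ 5/(4√Γ)`) and
`0 ≤ θ ≤ 1/500`. [folklore] -/
theorem termB_bound {Γ θ : ℝ} (hΓ : 0 < Γ) (hθ0 : 0 ≤ θ) (hθ1 : θ ≤ 1 / 500) (t : ℝ) {N : ℝ}
    (hN : N ^ 2 = 4 * Γ / 25 + t ^ 2) (hN0 : 0 ≤ N) :
    Γ * 4 / (4 * Real.pi) * (6 * (θ * |t|) / ((1 - θ) * N) ^ 2) ≤ 5 / 2 * θ * Real.sqrt Γ := by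
  have hG : 0 < Real.sqrt Γ := Real.sqrt_pos.2 hΓ
  have hG2 : Real.sqrt Γ ^ 2 = Γ := Real.sq_sqrt hΓ.le
  have hπ := Real.pi_gt_d2
  have hNpos : 0 < N := by nlinarith [sq_nonneg t]
  have hm2 : 0 < ((1 - θ) * N) ^ 2 := by
    have : 0 < 1 - θ := by linarith
    positivity
  rw [mul_div_assoc', div_le_iff₀ hm2, mul_pow, hN]
  have hAM : 4 * Real.sqrt Γ * |t| / 5 ≤ 4 * Γ / 25 + t ^ 2 := by
    nlinarith [sq_nonneg (2 * Real.sqrt Γ / 5 - |t|), sq_abs t, hG2]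
  have hAB : 4 * Γ * |t| / 5 ≤ Real.sqrt Γ * (4 * Γ / 25 + t ^ 2) := by
    have := mul_le_mul_of_nonneg_left hAM hG.le
    have h' : Real.sqrt Γ * (4 * Real.sqrt Γ * |t| / 5) = 4 * Γ * |t| / 5 := by
      linear_combination (4 * |t| / 5) * hG2
    linarith [h']
  have hB0 : 0 ≤ 4 * Γ * |t| / 5 := by positivity
  have h1θ : (996 / 1000 : ℝ) ≤ (1 - θ) ^ 2 := by nlinarith
  have ha : 996 / 1000 * (4 * Γ * |t| / 5) ≤ (1 - θ) ^ 2 * (Real.sqrt Γ * (4 * Γ / 25 + t ^ 2)) :=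
    mul_le_mul h1θ hAB hB0 (sq_nonneg _)
  have hb : 996 / 1000 * (4 * Γ * |t| / 5) * (314 / 100) ≤ (1 - θ) ^ 2 * (Real.sqrt Γ * (4 * Γ / 25 + t ^ 2)) * Real.pi :=
    mul_le_mul ha (by linarith) (by norm_num) (by positivity)
  have hlhs : Γ * 4 / (4 * Real.pi) * (6 * (θ * |t|)) = 6 * Γ * θ * |t| / Real.pi := by
    field_simp
  rw [hlhs, div_le_iff₀ Real.pi_pos]
  have hc := mul_le_mul_of_nonneg_left hb (by positivity : (0:ℝ) ≤ 5 / 2 * θ)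
  nlinarith [hc, mul_nonneg (mul_nonneg hθ0 hΓ.le) (abs_nonneg t)]

/-- **`C⁰` closeness of the TRUE partner field to the frozen rung-0 forcing.**  Let `z` be `C¹` with unit speed,
`z 0 = (√Γ/5, 0, 0)`, `‖z′ − e‖ ≤ θ` on `ℝ` with `0 ≤ θ ≤ 1/500`, and let `U` be the frozen rung-0 partner forcing.  Then
for every `t` the regularised Biot–Savart field of the partner `σ ↦ R_π(z σ)` at the point `z t` (times the box's
circulation factor `Γ·4/(4π)`) is within `28 θ √Γ` of `U t`. [folklore] -/
theorem partnerField_sub_U_le {Γ θ : ℝ} (hΓ : 0 < Γ) (hθ0 : 0 ≤ θ) (hθ1 : θ ≤ 1 / 500)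
    (U : ℝ → EuclideanSpace ℝ (Fin 3))
    (hU : ∀ t, U t = (2 * Γ / Real.pi / (4 * Γ / 25 + 1 + t ^ 2)) •
      ((2 * Real.sqrt Γ / 5) • (WithLp.toLp 2 ![0, (Real.sqrt 2)⁻¹, (Real.sqrt 2)⁻¹] : EuclideanSpace ℝ (Fin 3)) -
        t • WithLp.toLp 2 ![(1:ℝ), 0, 0]))
    {z : ℝ → EuclideanSpace ℝ (Fin 3)} (hz : ContDiff ℝ 1 z) (hunit : ∀ u, ‖deriv z u‖ = 1)
    (hz0 : z 0 = WithLp.toLp 2 ![Real.sqrt Γ / 5, 0, 0])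
    (hθ : ∀ s, ‖deriv z s - WithLp.toLp 2 ![0, (Real.sqrt 2)⁻¹, (Real.sqrt 2)⁻¹]‖ ≤ θ) (t : ℝ) :
    ‖(Γ * 4 / (4 * Real.pi)) • (∫ σ : ℝ,
        ((‖z t - ((2 * ⟪z σ, EuclideanSpace.single 2 1⟫_ℝ) • (EuclideanSpace.single (2 : Fin 3) (1 : ℝ)) - z σ)‖ ^ 2
            + 1) ^ (3 / 2 : ℝ))⁻¹ •
          cross (deriv (fun u => (2 * ⟪z u, EuclideanSpace.single 2 1⟫_ℝ) •
              (EuclideanSpace.single (2 : Fin 3) (1 : ℝ)) - z u) σ)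
            (z t - ((2 * ⟪z σ, EuclideanSpace.single 2 1⟫_ℝ) • (EuclideanSpace.single (2 : Fin 3) (1 : ℝ)) - z σ)))
        - U t‖ ≤ 28 * θ * Real.sqrt Γ := by
  have hG : 0 < Real.sqrt Γ := Real.sqrt_pos.2 hΓ
  have hG2 : Real.sqrt Γ ^ 2 = Γ := Real.sq_sqrt hΓ.le
  have hzd : Differentiable ℝ z := hz.differentiable one_ne_zero
  have hπ := Real.pi_gt_d2
  -- abbreviations that do NOT touch the goal
  obtain ⟨P, hP⟩ : ∃ P : EuclideanSpace ℝ (Fin 3), P = WithLp.toLp 2 ![Real.sqrt Γ / 5, 0, 0] := ⟨_, rfl⟩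
  obtain ⟨e, he⟩ : ∃ e : EuclideanSpace ℝ (Fin 3), e = WithLp.toLp 2 ![0, (Real.sqrt 2)⁻¹, (Real.sqrt 2)⁻¹] := ⟨_, rfl⟩
  obtain ⟨Q, hQ⟩ : ∃ Q : EuclideanSpace ℝ (Fin 3), Q = WithLp.toLp 2 ![-(Real.sqrt Γ / 5), 0, 0] := ⟨_, rfl⟩
  obtain ⟨e₂, he₂⟩ : ∃ e₂ : EuclideanSpace ℝ (Fin 3), e₂ = WithLp.toLp 2 ![0, -(Real.sqrt 2)⁻¹, (Real.sqrt 2)⁻¹] :=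
    ⟨_, rfl⟩
  have he₂1 : ‖e₂‖ = 1 := by rw [he₂]; exact norm_tangent₂
  -- the rotation as a continuous linear map
  set e₃ : EuclideanSpace ℝ (Fin 3) := EuclideanSpace.single (2 : Fin 3) (1 : ℝ) with he₃
  set L : EuclideanSpace ℝ (Fin 3) →L[ℝ] EuclideanSpace ℝ (Fin 3) :=
    (2 : ℝ) • (innerSL ℝ e₃).smulRight e₃ - ContinuousLinearMap.id ℝ (EuclideanSpace ℝ (Fin 3)) with hLdef
  have hL : ∀ y, L y = (2 * ⟪y, e₃⟫_ℝ) • e₃ - y := fun y => by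
    simp [hLdef, smul_smul, real_inner_comm]
  set X : ℝ → EuclideanSpace ℝ (Fin 3) := fun u => (2 * ⟪z u, e₃⟫_ℝ) • e₃ - z u with hXdef
  have hXL : X = fun u => L (z u) := by funext u; rw [hXdef, hL]
  have hXc : ContDiff ℝ 1 X := by rw [hXL]; exact L.contDiff.comp hz
  have hXd : ∀ u, deriv X u = L (deriv z u) := fun u => by
    rw [hXL]; exact (L.hasFDerivAt.comp_hasDerivAt u (hzd u).hasDerivAt).deriv
  have hdX : ∀ u, ‖deriv X u‖ ≤ 1 := fun u => by
    rw [hXd u, hL, norm_rotPi, hunit u]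
  have hgrowX : ∀ u, (1 - θ) * |u| - 0 ≤ ‖X u‖ := fun u => by
    rw [sub_zero, hXdef]; dsimp only; rw [norm_rotPi]
    exact arc_norm_ge hΓ.le hzd hz0 hθ u
  -- the straight partner line
  set X' : ℝ → EuclideanSpace ℝ (Fin 3) := fun u => Q + u • e₂ with hX'def
  have hX'c : ContDiff ℝ 1 X' := by rw [hX'def]; fun_prop
  have hX'd : ∀ u, deriv X' u = e₂ := fun u => by rw [hX'def, deriv_line]
  have hdX' : ∀ u, ‖deriv X' u‖ ≤ 1 := fun u => by rw [hX'd u, he₂1]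
  have hgrowX' : ∀ u, (1 - θ) * |u| - 0 ≤ ‖X' u‖ := fun u => by
    have h2 : ‖X' u‖ ^ 2 = Γ / 25 + u ^ 2 := by rw [hX'def]; dsimp only; rw [hQ, he₂]; exact norm_sq_line₂ Γ u hΓ.le
    have hn := norm_nonneg (X' u)
    have hu : |u| ≤ ‖X' u‖ := by nlinarith [sq_abs u, abs_nonneg u, hΓ, mul_nonneg hn (abs_nonneg u)]
    nlinarith [abs_nonneg u]
  -- closeness of the two partner curves (pivot form at `u₀ = 0`)
  have hLe : L e = e₂ := by rw [hL, he, he₂]; exact rotPi_tangent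
  have htan : ∀ u, ‖deriv X u - deriv X' u‖ ≤ θ := fun u => by
    rw [hXd u, hX'd u, ← hLe, hL, hL, rotPi_sub_norm, he]; exact hθ u
  have hLℓ : ∀ u, L (P + u • e) = X' u := fun u => by
    rw [hL, hP, he, hX'def]; dsimp only; rw [hQ, he₂]; exact rotPi_line Γ u
  have hpos : ∀ u, ‖X u - X' u‖ ≤ θ * |u - 0| := fun u => by
    rw [sub_zero, ← hLℓ u, hXL]; dsimp only; rw [hL, hL, rotPi_sub_norm]
    have := arc_displacement_le hzd hz0 hθ u
    rwa [← hP, ← he] at this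
  /- geometry of the straight partner line seen from `z t` and from `ℓ₁ t` -/
  have hw0 : (P + t • e - Q) - ⟪P + t • e - Q, e₂⟫_ℝ • e₂ = P + t • e - Q := by
    have : ⟪P + t • e - Q, e₂⟫_ℝ = 0 := by
      rw [hP, he, hQ, he₂, pt₁_sub_P₂, inner_vec3]; ring
    rw [this, zero_smul, sub_zero]
  have hN1sq : ‖P + t • e - Q‖ ^ 2 = 4 * Γ / 25 + t ^ 2 := by
    rw [hP, he, hQ, pt₁_sub_P₂, VortexFilament.norm_sq_toLp_three]
    have hs := inv_sqrt_two_mul_self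
    have hGG : Real.sqrt Γ * Real.sqrt Γ = Γ := Real.mul_self_sqrt hΓ.le
    linear_combination (2 * t ^ 2) * hs + (4 / 25) * hGG
  have hN1 : 0 ≤ ‖P + t • e - Q‖ := norm_nonneg _
  have hN1G : 2 * Real.sqrt Γ / 5 ≤ ‖P + t • e - Q‖ := by
    nlinarith [hN1sq, hG2, hG, sq_nonneg t, mul_nonneg hN1 hG.le]
  have hN1t : |t| ≤ ‖P + t • e - Q‖ := by
    nlinarith [hN1sq, sq_abs t, hΓ, abs_nonneg t, mul_nonneg hN1 (abs_nonneg t)]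
  have hdw : ‖((z t - Q) - ⟪z t - Q, e₂⟫_ℝ • e₂) - ((P + t • e - Q) - ⟪P + t • e - Q, e₂⟫_ℝ • e₂)‖ ≤ θ * |t| := by
    refine (norm_proj_sub_le e₂ (z t - Q) (P + t • e - Q) he₂1).trans ?_
    have : z t - Q - (P + t • e - Q) = z t - (P + t • e) := by abel
    rw [this]
    have h := arc_displacement_le hzd hz0 hθ t
    rwa [← hP, ← he] at h
  have hm : (1 - θ) * ‖P + t • e - Q‖ ≤ ‖(z t - Q) - ⟪z t - Q, e₂⟫_ℝ • e₂‖ := by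
    have h := norm_sub_norm_le ((P + t • e - Q) - ⟪P + t • e - Q, e₂⟫_ℝ • e₂) ((z t - Q) - ⟪z t - Q, e₂⟫_ℝ • e₂)
    have hdw' := hdw
    rw [norm_sub_rev] at hdw'
    rw [hw0] at h hdw'
    linarith only [h, hdw', mul_le_mul_of_nonneg_left hN1t hθ0]
  have hm0 : 0 < (1 - θ) * ‖P + t • e - Q‖ :=
    mul_pos (by linarith) (lt_of_lt_of_le (by positivity) hN1G)
  have hc : 0 < 1 - 2 * θ := by linarith
  have hAnum := termA_bound hΓ hθ0 hθ1
  have hBnum := termB_bound hΓ hθ0 hθ1 t hN1sq hN1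
  -- distances from the moving point `z t`
  have hθ4 : θ ≤ 1 / 4 := by linarith only [hθ1]
  have hD : 0 < (1 - 2 * θ) * (2 * Real.sqrt Γ / 5) := mul_pos hc (by positivity)
  have hsep := fun u => nearStraight_sep_rot hΓ hθ0 hθ4 hzd hz0 hθ t u
  have hsepL := fun u => nearStraight_sep_line hΓ hθ0 hθ4 hzd hz0 hθ t u
  have hfar : ∀ u, (1 - 2 * θ) * (2 * Real.sqrt Γ / 5) ≤ ‖z t - X u‖ := fun u => (hsep u).1
  have hfar' : ∀ u, (1 - 2 * θ) * (2 * Real.sqrt Γ / 5) ≤ ‖z t - X' u‖ := fun u => by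
    have h := (hsepL u).1
    rw [← hQ, ← he₂] at h
    have : (1 - 2 * θ) * (2 * Real.sqrt Γ / 5) ≤ (1 - θ) * (2 * Real.sqrt Γ / 5) :=
      mul_le_mul_of_nonneg_right (by linarith only [hθ0]) (by positivity)
    exact this.trans h
  have hesc : ∀ u, (1 - 2 * θ) * |u - 0| - 0 ≤ ‖z t - X u‖ := fun u => by
    rw [sub_zero, sub_zero]; exact (hsep u).2.1
  have hesc' : ∀ u, (1 - 2 * θ) * |u - 0| - 0 ≤ ‖z t - X' u‖ := fun u => by
    rw [sub_zero, sub_zero]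
    have h := (hsepL u).2
    rw [← hQ, ← he₂] at h
    have : (1 - 2 * θ) * |u| ≤ (1 - θ) * |u| :=
      mul_le_mul_of_nonneg_right (by linarith only [hθ0]) (abs_nonneg u)
    exact this.trans h
  /- Term A: the two partner curves seen from `z t` -/
  have hA := biotSavart_curveLipschitz (e := 1) (u₀ := 0) (y := z t) one_ne_zero (by linarith : 0 < 1 - θ)
    hXc hdX hgrowX hX'c hdX' hgrowX' hθ0 htan hpos hc hD le_rfl hfar hfar' hesc hesc'
  simp only [one_pow, add_zero] at hA
  /- Term B: the straight line's field at `z t` versus at `ℓ₁ t` -/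
  have hB1 := lineField_proj Q e₂ (z t) he₂1
  have hB0 := lineField_proj Q e₂ (P + t • e) he₂1
  have hw0le : (1 - θ) * ‖P + t • e - Q‖ ≤ ‖(P + t • e - Q) - ⟪P + t • e - Q, e₂⟫_ℝ • e₂‖ := by
    rw [hw0]; exact mul_le_of_le_one_left hN1 (by linarith)
  have hB := lineField_two_point e₂ he₂1 hm0 hm hw0le
  rw [← hB1, ← hB0] at hB
  /- the frozen forcing is the line's field at `ℓ₁ t` -/
  have hUeq : U t = (Γ * 4 / (4 * Real.pi)) • ∫ σ : ℝ,
      ((‖(P + t • e) - (Q + σ • e₂)‖ ^ 2 + 1) ^ (3 / 2 : ℝ))⁻¹ • cross e₂ ((P + t • e) - (Q + σ • e₂)) := by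
    rw [hP, he, hQ, he₂]; exact U_eq_lineBiotSavart hΓ.le U hU t
  /- assemble -/
  have hX'int : ∀ y : EuclideanSpace ℝ (Fin 3),
      (∫ u : ℝ, ((‖y - X' u‖ ^ 2 + 1) ^ (3 / 2 : ℝ))⁻¹ • cross (deriv X' u) (y - X' u)) =
        ∫ u : ℝ, ((‖y - (Q + u • e₂)‖ ^ 2 + 1) ^ (3 / 2 : ℝ))⁻¹ • cross e₂ (y - (Q + u • e₂)) := by
    intro y; simp only [hX'd]; simp only [hX'def]
  rw [hX'int] at hA
  have hgoal : (Γ * 4 / (4 * Real.pi)) • (∫ σ : ℝ, ((‖z t - X σ‖ ^ 2 + 1) ^ (3 / 2 : ℝ))⁻¹ •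
        cross (deriv X σ) (z t - X σ)) - U t =
      (Γ * 4 / (4 * Real.pi)) • ((∫ σ : ℝ, ((‖z t - X σ‖ ^ 2 + 1) ^ (3 / 2 : ℝ))⁻¹ • cross (deriv X σ) (z t - X σ)) -
          ∫ u : ℝ, ((‖z t - (Q + u • e₂)‖ ^ 2 + 1) ^ (3 / 2 : ℝ))⁻¹ • cross e₂ (z t - (Q + u • e₂))) +
      (Γ * 4 / (4 * Real.pi)) • ((∫ u : ℝ, ((‖z t - (Q + u • e₂)‖ ^ 2 + 1) ^ (3 / 2 : ℝ))⁻¹ • cross e₂ (z t - (Q + u • e₂))) -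
          ∫ σ : ℝ, ((‖(P + t • e) - (Q + σ • e₂)‖ ^ 2 + 1) ^ (3 / 2 : ℝ))⁻¹ • cross e₂ ((P + t • e) - (Q + σ • e₂))) := by
    rw [hUeq, smul_sub, smul_sub]; abel
  rw [hgoal]
  have hΓπ : 0 < Γ * 4 / (4 * Real.pi) := by positivity
  have hnormA := norm_smul_le (Γ * 4 / (4 * Real.pi)) ((∫ σ : ℝ, ((‖z t - X σ‖ ^ 2 + 1) ^ (3 / 2 : ℝ))⁻¹ •
      cross (deriv X σ) (z t - X σ)) - ∫ u : ℝ, ((‖z t - (Q + u • e₂)‖ ^ 2 + 1) ^ (3 / 2 : ℝ))⁻¹ • cross e₂ (z t - (Q + u • e₂)))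
  rw [Real.norm_eq_abs, abs_of_pos hΓπ] at hnormA
  have hnormB := norm_smul_le (Γ * 4 / (4 * Real.pi)) ((∫ u : ℝ, ((‖z t - (Q + u • e₂)‖ ^ 2 + 1) ^ (3 / 2 : ℝ))⁻¹ •
      cross e₂ (z t - (Q + u • e₂))) -
      ∫ σ : ℝ, ((‖(P + t • e) - (Q + σ • e₂)‖ ^ 2 + 1) ^ (3 / 2 : ℝ))⁻¹ • cross e₂ ((P + t • e) - (Q + σ • e₂)))
  rw [Real.norm_eq_abs, abs_of_pos hΓπ] at hnormB
  have hBle : ‖(∫ u : ℝ, ((‖z t - (Q + u • e₂)‖ ^ 2 + 1) ^ (3 / 2 : ℝ))⁻¹ • cross e₂ (z t - (Q + u • e₂))) -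
      ∫ σ : ℝ, ((‖(P + t • e) - (Q + σ • e₂)‖ ^ 2 + 1) ^ (3 / 2 : ℝ))⁻¹ • cross e₂ ((P + t • e) - (Q + σ • e₂))‖ ≤
      6 * (θ * |t|) / ((1 - θ) * ‖P + t • e - Q‖) ^ 2 :=
    hB.trans (div_le_div_of_nonneg_right (mul_le_mul_of_nonneg_left hdw (by norm_num)) (sq_nonneg _))
  calc _ ≤ ‖(Γ * 4 / (4 * Real.pi)) • ((∫ σ : ℝ, ((‖z t - X σ‖ ^ 2 + 1) ^ (3 / 2 : ℝ))⁻¹ • cross (deriv X σ) (z t - X σ)) -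
          ∫ u : ℝ, ((‖z t - (Q + u • e₂)‖ ^ 2 + 1) ^ (3 / 2 : ℝ))⁻¹ • cross e₂ (z t - (Q + u • e₂)))‖ +
        ‖(Γ * 4 / (4 * Real.pi)) • ((∫ u : ℝ, ((‖z t - (Q + u • e₂)‖ ^ 2 + 1) ^ (3 / 2 : ℝ))⁻¹ • cross e₂ (z t - (Q + u • e₂))) -
          ∫ σ : ℝ, ((‖(P + t • e) - (Q + σ • e₂)‖ ^ 2 + 1) ^ (3 / 2 : ℝ))⁻¹ • cross e₂ ((P + t • e) - (Q + σ • e₂)))‖ :=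
        norm_add_le _ _
    _ ≤ 51 / 2 * θ * Real.sqrt Γ + 5 / 2 * θ * Real.sqrt Γ := by
        refine add_le_add (hnormA.trans ?_) (hnormB.trans ?_)
        · exact (mul_le_mul_of_nonneg_left hA hΓπ.le).trans hAnum
        · exact (mul_le_mul_of_nonneg_left hBle hΓπ.le).trans hBnum
    _ = 28 * θ * Real.sqrt Γ := by ring

end SelectionBoxRJRung

end Summit.NavierStokesRegularity.NavierStokesRegularity.Theorems
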